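import Literature.NumberTheory.EllipticCurves.GreenbergSelmerCofreeReductionPk
import Summits.BirchSwinnertonDyer.BirchSwinnertonDyer.Theorems.ResidualThetaTransportAtTwoResidualSignedLambdaLowerCMAtTwoSelmerDualFinite
import HarnessLib

/-!
# `A_ρ[p^k]` is FINITE (`≅ (𝒪/p^k)ⁿ`) — the `[Finite M]` binder of the ρ-coefficient layer Tate pairing (PIN-SPEC-S2 D2(d))

Route `ResidualThetaTransportAtTwo` (RTT), crux RSL_g `ResidualSignedLambdaLowerCMAtTwo` (stmt-BirchSwinnertonDyer-22608); seat `prover-bsd-wall-rtt-p2` g16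
(`--supports`, closes nothing). THEOREMS ONLY. The generic layer pairing `CyclotomicLayer.layerPairingH1Of` (p671651) is stated for a FINITE discrete
Galois module; for `M = A_ρ[p^k] = (Cofree ρ F)[p^k]` (`GreenbergSelmer.cofreeTorsionGaloisModule`, p671214) finiteness is: the reduction map
`divPowCofreeMk : 𝒪ⁿ → A_ρ` (p670433) is `𝒪`-linear, kills `p^k 𝒪ⁿ`, and is ONTO `A_ρ[p^k]`; and `𝒪ⁿ/p^k𝒪ⁿ` is finite (`𝒪/p` finite for `ℚ_p(S)/ℚ_p` finite,
`Ideal.finite_quotient_pow`, `Submodule.finite_quotient_smul`). BSD is not proved by any of this.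

* `finite_quotient_span_natCast_prime_padicCoeffIntegers`, `finite_quotient_span_natCast_prime_pow_padicCoeffIntegers` (`𝒪/p`, `𝒪/p^k` finite);
* `divPowCofreeMk_smul_left` (`𝒪`-linearity), `mem_range_divPowCofreeMk_of_mem_torsionBy` (onto `A_ρ[p^k]`);
* **`finite_torsionBy_cofree_pow`** — `Finite ↥((Cofree ρ F)[p^k])`.
-/

set_option autoImplicit false
-- the Theorems namespace of this sub repeats the summit name by design (D-0017 nested layout)
set_option linter.dupNamespace false

noncomputable section

open scoped Classical

namespace Summit.BirchSwinnertonDyer.BirchSwinnertonDyer.Theorems.LambdaLowerBoundO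

open Literature.NumberTheory.EllipticCurves Literature.NumberTheory.EllipticCurves.GreenbergSelmer
open Literature.NumberTheory.GaloisRepresentations NumberField IsDedekindDomain Field

section Quotients

variable {p : ℕ} [Fact p.Prime] (S : Set (PadicAlgCl p)) [FiniteDimensional ℚ_[p] (padicCoeffField S)]

/-- `𝒪/p` is finite for `𝒪 = padicCoeffIntegers S`, `ℚ_p(S)/ℚ_p` finite (transported from the unit ball). [cite: NeukirchANT1999, Ch. II (4.8)] -/
theorem finite_quotient_span_natCast_prime_padicCoeffIntegers :
    Finite (padicCoeffIntegers S ⧸ Ideal.span {((p : ℕ) : padicCoeffIntegers S)}) := by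
  rw [padicCoeffIntegers_eq_unitBall S]
  exact finite_quotient_span_prime_unitBall p _

/-- `𝒪/p^k` is finite (`Ideal.finite_quotient_pow`). [cite: NeukirchANT1999, Ch. II (4.8)] -/
theorem finite_quotient_span_natCast_prime_pow_padicCoeffIntegers (k : ℕ) :
    Finite (padicCoeffIntegers S ⧸ Ideal.span {((p : ℕ) : padicCoeffIntegers S) ^ k}) := by
  haveI := finite_quotient_span_natCast_prime_padicCoeffIntegers S
  rw [← Ideal.span_singleton_pow]
  exact Ideal.finite_quotient_pow ⟨{((p : ℕ) : padicCoeffIntegers S)}, by simp⟩ k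

end Quotients

section Torsion

variable {p : ℕ} [Fact p.Prime] (S : Set (PadicAlgCl p)) {n : ℕ}
  (ρ : FramedGaloisRep ℚ (padicCoeffIntegers S) n) (k : ℕ)

/-- `divPowCofreeMk` is `𝒪`-homogeneous: `div (a • t) = a • div t`. [cite: Kato2004Asterisque, §13.8 (p. 228)] -/
theorem divPowCofreeMk_smul_left (a : padicCoeffIntegers S) (t : Fin n → padicCoeffIntegers S) :
    divPowCofreeMk S ρ k (a • t) = a • divPowCofreeMk S ρ k t := by
  rw [divPowCofreeMk_apply, divPowCofreeMk_apply, ← map_smul]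
  congr 1
  funext i
  show ((p : padicCoeffField S)⁻¹) ^ k * algebraMap (padicCoeffIntegers S) (padicCoeffField S) ((a • t) i) =
    a • (((p : padicCoeffField S)⁻¹) ^ k * algebraMap (padicCoeffIntegers S) (padicCoeffField S) (t i))
  rw [Pi.smul_apply, smul_eq_mul, map_mul, Algebra.smul_def]
  ring

/-- **`divPowCofreeMk` is ONTO `A_ρ[p^k]`**: a class `x mod 𝒪ⁿ` killed by `p^k` has `p^k x ∈ 𝒪ⁿ`, so `x = p^{-k}t`. [cite: Greenberg1989, §1 p. 98] -/
theorem mem_range_divPowCofreeMk_of_mem_torsionBy (a : Cofree ρ (padicCoeffField S))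
    (ha : a ∈ AddSubgroup.torsionBy (Cofree ρ (padicCoeffField S)) ((p ^ k : ℕ) : ℤ)) :
    a ∈ Set.range (divPowCofreeMk S ρ k) := by
  obtain ⟨x, rfl⟩ := cofreeMk_surjective (padicCoeffField S) ρ a
  rw [AddSubgroup.torsionBy, Submodule.mem_toAddSubgroup, Submodule.mem_torsionBy_iff, natCast_zsmul, ← map_nsmul,
    ← LinearMap.mem_ker, ker_cofreeMk, mem_lattice_iff] at ha
  obtain ⟨t, ht⟩ := ha
  refine ⟨t, ?_⟩
  rw [divPowCofreeMk_apply, ht]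
  congr 1
  have hp : (p : padicCoeffField S) ≠ 0 := Nat.cast_ne_zero.mpr (Fact.out : p.Prime).ne_zero
  rw [← Nat.cast_smul_eq_nsmul (padicCoeffField S), smul_smul, Nat.cast_pow, ← mul_pow, inv_mul_cancel₀ hp, one_pow, one_smul]

/-- **`A_ρ[p^k]` is finite** (`≅` a quotient of `𝒪ⁿ/p^k𝒪ⁿ`, which is finite for `ℚ_p(S)/ℚ_p` finite) — the `[Finite M]` binder of
`CyclotomicLayer.layerPairingH1Of` for `M = A_ρ[p^k]`. [cite: Greenberg1989, §1 p. 98] [cite: NeukirchANT1999, Ch. II (4.8)] -/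
theorem finite_torsionBy_cofree_pow [FiniteDimensional ℚ_[p] (padicCoeffField S)] :
    Finite ↥(AddSubgroup.torsionBy (Cofree ρ (padicCoeffField S)) ((p ^ k : ℕ) : ℤ)) := by
  -- the `𝒪`-linear reduction and its kernel `⊇ p^k 𝒪ⁿ`
  let L : (Fin n → padicCoeffIntegers S) →ₗ[padicCoeffIntegers S] Cofree ρ (padicCoeffField S) :=
    { toFun := divPowCofreeMk S ρ k
      map_add' := map_add _
      map_smul' := divPowCofreeMk_smul_left S ρ k }
  set I : Ideal (padicCoeffIntegers S) := Ideal.span {((p : ℕ) : padicCoeffIntegers S) ^ k} with hI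
  have hle : I • (⊤ : Submodule (padicCoeffIntegers S) (Fin n → padicCoeffIntegers S)) ≤ LinearMap.ker L := by
    rw [Submodule.smul_le]
    rintro r hr t -
    obtain ⟨a, rfl⟩ := Ideal.mem_span_singleton'.mp hr
    rw [LinearMap.mem_ker, map_smul, mul_smul]
    change a • (((p : ℕ) : padicCoeffIntegers S) ^ k • divPowCofreeMk S ρ k t) = 0
    rw [← Nat.cast_pow, Nat.cast_smul_eq_nsmul, pow_smul_divPowCofreeMk, smul_zero]
  haveI : Finite (padicCoeffIntegers S ⧸ I) := finite_quotient_span_natCast_prime_pow_padicCoeffIntegers S k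
  haveI : Finite ((Fin n → padicCoeffIntegers S) ⧸ I • (⊤ : Submodule (padicCoeffIntegers S) (Fin n → padicCoeffIntegers S))) :=
    Submodule.finite_quotient_smul I Module.Finite.fg_top
  -- `A[p^k] ⊆ range (liftQ L)`
  have hsub : (AddSubgroup.torsionBy (Cofree ρ (padicCoeffField S)) ((p ^ k : ℕ) : ℤ) : Set (Cofree ρ (padicCoeffField S))) ⊆
      Set.range (Submodule.liftQ (I • ⊤) L hle) := by
    intro a ha
    obtain ⟨t, rfl⟩ := mem_range_divPowCofreeMk_of_mem_torsionBy S ρ k a ha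
    exact ⟨Submodule.Quotient.mk t, rfl⟩
  exact ((Set.finite_range _).subset hsub).to_subtype

end Torsion

end Summit.BirchSwinnertonDyer.BirchSwinnertonDyer.Theorems.LambdaLowerBoundO

end
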